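/-
Copyright (c) 2026. All rights reserved.
Released under Apache 2.0 license as described in the file LICENSE.
-/
import Summits.AtomisticToContinuum.Crystallization.Theorems.ChartedZeroExcessLayeredLatticeLiouvilleVO

/-!
# ChartedZeroExcessLayeredLatticeLiouville — part VP «IncrementCoercive I»: the chain blocks as operators, the flux blocks, and the INCREMENT FORM
  of the chain flux (decomp-a2c-lens-2, g58; helper of stmt-AtomisticToContinuum-26636, leaf (LD′) `ModalLipschitzZ`; brick (3) MODE EXTRACTION,
  critic rows 929 (b) / 938 / 941 (e))

The window solves of VM/VN act on a block family `B : ℤ → ℤ → (E3 →L[ℝ] E3)`; this part builds THE family of the laminate's chain and puts VO's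
chain flux in increment form.
* VP.1 generic bookkeeping: sums over two index sets agreeing on the support, TELESCOPING over integer intervals, the band in index currency
  (`c·|β − α| ≤ ϱ ⇒ |β − α| ≤ r := ⌊ϱ/c⌋₊`, so `chainK (0, α) β = 0` once `|β − α| > r`);
* VP.2 `chainKL α β : E3 →L[ℝ] E3` — the chain block `chainK (0, α) β` as an operator (linear by VI `chainK_add/smul`), with the crude bound
  `‖chainKL α β‖ ≤ (2r+1)³·F(c)` (UY `kernelConst`; at most `(2r+1)³` near sites) — and the FLUX BLOCKS
  `fluxBlock m k = Σ_{α ∈ [m − r, min m k]} Σ_{β ∈ [max m k + 1, m + 1 + r]} chainKL α β`, zero for `|k − m| > r` (EMPTY ranges — no kernel estimate),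
  `‖fluxBlock m k‖ ≤ fluxConst c ϱ := (r+1)²(2r+1)³·F(c)`;
* VP.3 ★★ THE INCREMENT FORM: for every carrier `T ⊇ [m − r, m + 1 + r]`,
  `chainFlux T cf m = Σ_{k ∈ [m − r, m + r]} fluxBlock m k (cf (k+1) − cf k)` (`chainFlux_eq_sum_fluxBlock`: restriction to the band box,
  telescoping `cf β − cf α = Σ_{α ≤ k < β} (cf (k+1) − cf k)`, exchange of sums) — the flux through a gap is a BANDED operator on the
  nearest-layer increments; with VO `chainForm_eq_two_mul_sum_inner_chainFlux` the chain energy becomes the pairing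
  `2·Σ_m ⟪d m, Σ_k fluxBlock m k (d k)⟫` of the increment field `d`, i.e. VM's `blockApply (fluxBlock …)`;
* VP.4 `primZ d l n = Σ_{k ∈ [l, n)} d k`, the profile of an increment field (its increments are `d`).
Part VQ closes an increment field supported in a window by a far slow ramp and derives, from VL `chainCoercive_of_coerciveZ`, the coercivity
`(κ₀ − ε/2)·Σ_{m ∈ W} ‖d m‖² ≤ Σ_{m ∈ W} ⟪d m, blockApply (fluxBlock …) W d m⟫` — hypothesis `hco` of VM/VN for every window `W`.
-/

namespace Summit.AtomisticToContinuum.Crystallization.Theorems.ChartedZeroExcessLayeredLatticeLiouville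

open Summit.AtomisticToContinuum.Crystallization.Theorems.ChartedPlanarOrderRigidityDoor (E3)
open Finset
open scoped InnerProductSpace RealInnerProductSpace BigOperators

noncomputable section IncrementForm

variable {c : ℝ} {a b : E3} {w : ℤ → E3}

/-! ### VP.1  Generic bookkeeping: equal sums, telescoping over `ℤ`, the band in index currency -/

/-- two finite sums of one function agree when each index set carries the part of the support inside the other. [formal bookkeeping] -/
theorem sum_eq_sum_of_vanish {M : Type*} [AddCommMonoid M] {f : ℤ → M} {A B : Finset ℤ}
    (hA : ∀ k ∈ A, k ∉ B → f k = 0) (hB : ∀ k ∈ B, k ∉ A → f k = 0) : ∑ k ∈ A, f k = ∑ k ∈ B, f k := by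
  have h1 : ∑ k ∈ A, f k = ∑ k ∈ A ∪ B, f k :=
    sum_subset subset_union_left fun k hk hkA => by
      rcases mem_union.mp hk with h | h
      · exact absurd h hkA
      · exact hB k h hkA
  have h2 : ∑ k ∈ B, f k = ∑ k ∈ A ∪ B, f k :=
    sum_subset subset_union_right fun k hk hkB => by
      rcases mem_union.mp hk with h | h
      · exact hA k h hkB
      · exact absurd h hkB
  rw [h1, h2]

/-- TELESCOPING over an integer interval: `Σ_{k ∈ [α, β)} (cf (k+1) − cf k) = cf β − cf α`. [formal bookkeeping] -/
theorem sum_Ico_sub_eq (cf : ℤ → E3) {α β : ℤ} (h : α ≤ β) : ∑ k ∈ Ico α β, (cf (k + 1) - cf k) = cf β - cf α := by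
  obtain ⟨n, rfl⟩ := Int.le.dest h
  clear h
  induction n with
  | zero => simp
  | succ n ih =>
    have h1 : α ≤ α + (n : ℕ) := by omega
    have h2 : α + ((n + 1 : ℕ) : ℤ) = α + (n : ℕ) + 1 := by push_cast; ring
    have h3 : Ico (α + (n : ℕ)) (α + (n : ℕ) + 1) = {α + (n : ℕ)} := by
      ext x
      rw [mem_Ico, mem_singleton]
      omega
    rw [h2, ← Ico_union_Ico_eq_Ico h1 (by omega), sum_union (Ico_disjoint_Ico_consecutive _ _ _), ih, h3, sum_singleton]
    abel

/-- telescoping over the part of an index set between `α` and `β`, for index sets containing `[α, β)`. [formal bookkeeping] -/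
theorem sum_filter_sub_eq (cf : ℤ → E3) {I : Finset ℤ} {α β : ℤ} (h : α ≤ β) (hI : ∀ k, α ≤ k → k < β → k ∈ I) :
    ∑ k ∈ I with (α ≤ k ∧ k < β), (cf (k + 1) - cf k) = cf β - cf α := by
  have hf : (I.filter fun k => α ≤ k ∧ k < β) = Ico α β := by
    ext k
    rw [mem_filter, mem_Ico]
    exact ⟨fun hk => hk.2, fun hk => ⟨hI k hk.1 hk.2, hk⟩⟩
  rw [hf, sum_Ico_sub_eq cf h]

/-- the band in index currency: `c·|β − α| ≤ ϱ` forces `|β − α| ≤ ⌊ϱ/c⌋₊`. [formal bookkeeping] -/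
theorem natAbs_le_floor_of_band (hc : 0 < c) {ϱ : ℝ} {α β : ℤ} (h : c * |(((β - α : ℤ)) : ℝ)| ≤ ϱ) :
    (β - α).natAbs ≤ ⌊ϱ / c⌋₊ := by
  refine Nat.le_floor ?_
  rw [le_div_iff₀ hc, mul_comm, Nat.cast_natAbs, Int.cast_abs]
  exact h

/-- the chain block between layers more than `⌊ϱ/c⌋₊` apart vanishes (VI `chainK_eq_zero_of_far` in index currency). [formal bookkeeping] -/
theorem chainK_eq_zero_of_lt_natAbs (hc : 0 < c) (hL : IsLayeredCrystal c a b w) {ϱ : ℝ} {α β : ℤ}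
    (h : ⌊ϱ / c⌋₊ < (β - α).natAbs) (u : E3) : chainK ϱ a b w ((0 : Cell 2), α) β u = 0 :=
  chainK_eq_zero_of_far hc hL (X := ((0 : Cell 2), α)) (not_le.mp fun hle => (not_le.mpr h) (natAbs_le_floor_of_band hc hle)) u

/-! ### VP.2  The chain blocks as operators and the flux blocks -/

/-- the chain block `chainK (0, α) β` as a continuous linear operator on `E3` (co-Lipschitz crystal; linear by VI `chainK_add` / `chainK_smul`).
[this file, g58] -/
def chainKL (hc : 0 < c) (hL : IsLayeredCrystal c a b w) (ϱ : ℝ) (α β : ℤ) : E3 →L[ℝ] E3 :=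
  LinearMap.toContinuousLinearMap
    { toFun := fun u => chainK ϱ a b w ((0 : Cell 2), α) β u
      map_add' := fun u v => chainK_add hc hL ϱ _ β u v
      map_smul' := fun r u => by
        simp only [RingHom.id_apply]
        exact chainK_smul hc hL ϱ _ β r u }

/-- `chainKL α β u = chainK (0, α) β u`. [formal bookkeeping] -/
theorem chainKL_apply (hc : 0 < c) (hL : IsLayeredCrystal c a b w) (ϱ : ℝ) (α β : ℤ) (u : E3) :
    chainKL hc hL ϱ α β u = chainK ϱ a b w ((0 : Cell 2), α) β u := rfl

/-- a crude OPERATOR BOUND for the chain blocks: `‖chainKL α β‖ ≤ (2⌊ϱ/c⌋₊+1)³·F(c)` (the block is a sum over at most `(2r+1)³` near sites — they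
lie in the index ball of radius `ϱ/c`, VE `card_idxBallF_eq` — of truncated kernels bounded by UY's `kernelConst`). [this file, g58] -/
theorem norm_chainKL_le (hc : 0 < c) (hL : IsLayeredCrystal c a b w) {ϱ : ℝ} (hϱ : 0 ≤ ϱ) (α β : ℤ) :
    ‖chainKL hc hL ϱ α β‖ ≤ (((2 * ⌊ϱ / c⌋₊ + 1) ^ 3 : ℕ) : ℝ) * kernelConst c := by
  refine ContinuousLinearMap.opNorm_le_bound _ (mul_nonneg (Nat.cast_nonneg _) (kernelConst_nonneg hc)) fun u => ?_
  set X : Cell 2 × ℤ := ((0 : Cell 2), α) with hX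
  have hN : ∀ Y : Cell 2 × ℤ, ‖lsite a b w Y.1 Y.2 - lsite a b w X.1 X.2‖ ≤ ϱ → Y ∈ (finite_near_lsite hc hL X ϱ).toFinset :=
    fun _ hY => (finite_near_lsite hc hL X ϱ).mem_toFinset.mpr hY
  rw [chainKL_apply, chainK_eq_sum hN]
  have hsub : ((finite_near_lsite hc hL X ϱ).toFinset.filter fun Y => Y.2 = β) ⊆ idxBallF X (ϱ / c) := by
    intro Y hY
    have hY' := (finite_near_lsite hc hL X ϱ).mem_toFinset.mp (mem_filter.mp hY).1
    rw [mem_idxBallF, le_div_iff₀ hc, mul_comm]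
    exact (hL Y X).trans hY'
  have hcard : ((((finite_near_lsite hc hL X ϱ).toFinset.filter fun Y => Y.2 = β).card : ℕ) : ℝ) ≤ (((2 * ⌊ϱ / c⌋₊ + 1) ^ 3 : ℕ) : ℝ) := by
    have h := card_le_card hsub
    rw [card_idxBallF_eq X (div_nonneg hϱ hc.le)] at h
    exact_mod_cast h
  calc ‖∑ Y ∈ (finite_near_lsite hc hL X ϱ).toFinset with Y.2 = β, nearK ϱ a b w X Y u‖
      ≤ ∑ Y ∈ (finite_near_lsite hc hL X ϱ).toFinset with Y.2 = β, ‖nearK ϱ a b w X Y u‖ := norm_sum_le _ _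
    _ ≤ ∑ Y ∈ (finite_near_lsite hc hL X ϱ).toFinset with Y.2 = β, kernelConst c * ‖u‖ :=
        sum_le_sum fun Y _ => norm_nearK_le_kernelConst hc hL ϱ X Y u
    _ = ((((finite_near_lsite hc hL X ϱ).toFinset.filter fun Y => Y.2 = β).card : ℕ) : ℝ) * (kernelConst c * ‖u‖) := by
        rw [sum_const, nsmul_eq_mul]
    _ ≤ (((2 * ⌊ϱ / c⌋₊ + 1) ^ 3 : ℕ) : ℝ) * (kernelConst c * ‖u‖) :=
        mul_le_mul_of_nonneg_right hcard (mul_nonneg (kernelConst_nonneg hc) (norm_nonneg u))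
    _ = (((2 * ⌊ϱ / c⌋₊ + 1) ^ 3 : ℕ) : ℝ) * kernelConst c * ‖u‖ := by ring

/-- the FLUX BLOCKS of the chain: `fluxBlock m k = Σ_{α ∈ [m − r, min m k]} Σ_{β ∈ [max m k + 1, m + 1 + r]} chainKL α β` (`r = ⌊ϱ/c⌋₊`) — the operator
through which the increment `cf (k+1) − cf k` enters the chain flux through the gap above layer `m` (`chainFlux_eq_sum_fluxBlock`); one of the two
ranges is EMPTY once `|k − m| > r`. [this file, g58] -/
def fluxBlock (hc : 0 < c) (hL : IsLayeredCrystal c a b w) (ϱ : ℝ) (m k : ℤ) : E3 →L[ℝ] E3 :=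
  ∑ α ∈ Icc (m - ⌊ϱ / c⌋₊) (min m k), ∑ β ∈ Icc (max m k + 1) (m + 1 + ⌊ϱ / c⌋₊), chainKL hc hL ϱ α β

/-- the flux block applied to a vector. [formal bookkeeping] -/
theorem fluxBlock_apply (hc : 0 < c) (hL : IsLayeredCrystal c a b w) (ϱ : ℝ) (m k : ℤ) (u : E3) :
    fluxBlock hc hL ϱ m k u =
      ∑ α ∈ Icc (m - ⌊ϱ / c⌋₊) (min m k), ∑ β ∈ Icc (max m k + 1) (m + 1 + ⌊ϱ / c⌋₊), chainK ϱ a b w ((0 : Cell 2), α) β u := by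
  simp only [fluxBlock, _root_.sum_apply, chainKL_apply]

/-- the flux blocks are BANDED: `fluxBlock m k = 0` for `k ∉ [m − r, m + r]` (an empty summation range). [formal bookkeeping] -/
theorem fluxBlock_eq_zero_of_not_mem (hc : 0 < c) (hL : IsLayeredCrystal c a b w) (ϱ : ℝ) {m k : ℤ}
    (h : k ∉ Icc (m - ⌊ϱ / c⌋₊) (m + ⌊ϱ / c⌋₊)) : fluxBlock hc hL ϱ m k = 0 := by
  rw [mem_Icc, not_and_or, not_le, not_le] at h
  unfold fluxBlock
  rcases h with h | h
  · rw [Icc_eq_empty_of_lt (lt_of_le_of_lt (min_le_right m k) h), sum_empty]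
  · refine sum_eq_zero fun α _ => ?_
    have hlt : m + 1 + (⌊ϱ / c⌋₊ : ℤ) < max m k + 1 := by have := le_max_right m k; omega
    rw [Icc_eq_empty_of_lt hlt, sum_empty]

/-- the crude FLUX BLOCK CONSTANT `(r+1)²·(2r+1)³·F(c)`, `r = ⌊ϱ/c⌋₊` (VQ's ramp estimate only needs SOME bound; the `ϱ`-uniform decay bounds are a
later part). [this file, g58] -/
def fluxConst (c ϱ : ℝ) : ℝ :=
  ((((⌊ϱ / c⌋₊ + 1) ^ 2 * (2 * ⌊ϱ / c⌋₊ + 1) ^ 3 : ℕ)) : ℝ) * kernelConst c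

/-- `0 ≤ fluxConst c ϱ`. [formal bookkeeping] -/
theorem fluxConst_nonneg (hc : 0 < c) (ϱ : ℝ) : 0 ≤ fluxConst c ϱ :=
  mul_nonneg (Nat.cast_nonneg _) (kernelConst_nonneg hc)

/-- ★ the crude bound `‖fluxBlock m k‖ ≤ fluxConst c ϱ` (at most `(r+1)²` chain blocks, each `≤ (2r+1)³·F(c)`). [this file, g58] -/
theorem norm_fluxBlock_le (hc : 0 < c) (hL : IsLayeredCrystal c a b w) {ϱ : ℝ} (hϱ : 0 ≤ ϱ) (m k : ℤ) :
    ‖fluxBlock hc hL ϱ m k‖ ≤ fluxConst c ϱ := by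
  have hA : (((Icc (m - ⌊ϱ / c⌋₊) (min m k)).card : ℕ) : ℝ) ≤ (⌊ϱ / c⌋₊ : ℝ) + 1 := by
    rw [Int.card_Icc]
    have : (min m k + 1 - (m - ⌊ϱ / c⌋₊)).toNat ≤ ⌊ϱ / c⌋₊ + 1 := by have := min_le_left m k; omega
    exact_mod_cast this
  have hB : (((Icc (max m k + 1) (m + 1 + ⌊ϱ / c⌋₊)).card : ℕ) : ℝ) ≤ (⌊ϱ / c⌋₊ : ℝ) + 1 := by
    rw [Int.card_Icc]
    have : (m + 1 + ⌊ϱ / c⌋₊ + 1 - (max m k + 1)).toNat ≤ ⌊ϱ / c⌋₊ + 1 := by have := le_max_left m k; omega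
    exact_mod_cast this
  have hK : 0 ≤ (((2 * ⌊ϱ / c⌋₊ + 1) ^ 3 : ℕ) : ℝ) * kernelConst c := mul_nonneg (Nat.cast_nonneg _) (kernelConst_nonneg hc)
  unfold fluxBlock
  calc ‖∑ α ∈ Icc (m - (⌊ϱ / c⌋₊ : ℤ)) (min m k), ∑ β ∈ Icc (max m k + 1) (m + 1 + ⌊ϱ / c⌋₊), chainKL hc hL ϱ α β‖
      ≤ ∑ α ∈ Icc (m - (⌊ϱ / c⌋₊ : ℤ)) (min m k), ‖∑ β ∈ Icc (max m k + 1) (m + 1 + ⌊ϱ / c⌋₊), chainKL hc hL ϱ α β‖ := norm_sum_le _ _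
    _ ≤ ∑ α ∈ Icc (m - (⌊ϱ / c⌋₊ : ℤ)) (min m k), ∑ β ∈ Icc (max m k + 1) (m + 1 + ⌊ϱ / c⌋₊), ‖chainKL hc hL ϱ α β‖ :=
        sum_le_sum fun α _ => norm_sum_le _ _
    _ ≤ ∑ α ∈ Icc (m - (⌊ϱ / c⌋₊ : ℤ)) (min m k), ∑ β ∈ Icc (max m k + 1) (m + 1 + ⌊ϱ / c⌋₊),
          (((2 * ⌊ϱ / c⌋₊ + 1) ^ 3 : ℕ) : ℝ) * kernelConst c := sum_le_sum fun α _ => sum_le_sum fun β _ => norm_chainKL_le hc hL hϱ α β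
    _ = (((Icc (m - ⌊ϱ / c⌋₊) (min m k)).card : ℕ) : ℝ) *
          ((((Icc (max m k + 1) (m + 1 + ⌊ϱ / c⌋₊)).card : ℕ) : ℝ) * ((((2 * ⌊ϱ / c⌋₊ + 1) ^ 3 : ℕ) : ℝ) * kernelConst c)) := by
        simp only [sum_const, nsmul_eq_mul]
    _ ≤ ((⌊ϱ / c⌋₊ : ℝ) + 1) * (((⌊ϱ / c⌋₊ : ℝ) + 1) * ((((2 * ⌊ϱ / c⌋₊ + 1) ^ 3 : ℕ) : ℝ) * kernelConst c)) := by gcongr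
    _ = fluxConst c ϱ := by unfold fluxConst; push_cast; ring

/-! ### VP.3  ★★ The increment form of the chain flux -/

/-- ★ RESTRICTION TO THE BAND BOX: for a carrier containing `[m − r, m + 1 + r]` (`r = ⌊ϱ/c⌋₊`) the chain flux through the gap above `m` is the double
sum over `α ∈ [m − r, m]`, `β ∈ [m + 1, m + 1 + r]` (entries farther than `r` apart vanish, `chainK_eq_zero_of_lt_natAbs`). [this file, g58] -/
theorem chainFlux_eq_box (hc : 0 < c) (hL : IsLayeredCrystal c a b w) {ϱ : ℝ} (cf : ℤ → E3) {T : Finset ℤ} {m : ℤ}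
    (hT : Icc (m - ⌊ϱ / c⌋₊) (m + 1 + ⌊ϱ / c⌋₊) ⊆ T) :
    chainFlux ϱ a b w T cf m =
      ∑ α ∈ Icc (m - ⌊ϱ / c⌋₊) m, ∑ β ∈ Icc (m + 1) (m + 1 + ⌊ϱ / c⌋₊), chainK ϱ a b w ((0 : Cell 2), α) β (cf β - cf α) := by
  have hfar : ∀ α β : ℤ, ⌊ϱ / c⌋₊ < (β - α).natAbs → chainK ϱ a b w ((0 : Cell 2), α) β (cf β - cf α) = 0 :=
    fun α β h => chainK_eq_zero_of_lt_natAbs hc hL h _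
  unfold chainFlux
  -- (i) restrict the outer sum to `α ∈ [m − r, m]`: rows below the box vanish entry by entry
  have hout : ∑ α ∈ Icc (m - (⌊ϱ / c⌋₊ : ℤ)) m, ∑ β ∈ T with m < β, chainK ϱ a b w ((0 : Cell 2), α) β (cf β - cf α) =
      ∑ α ∈ T with α ≤ m, ∑ β ∈ T with m < β, chainK ϱ a b w ((0 : Cell 2), α) β (cf β - cf α) := by
    refine sum_subset (fun α hα => ?_) (fun α hα hα' => ?_)
    · rw [mem_Icc] at hα
      exact mem_filter.mpr ⟨hT (mem_Icc.mpr ⟨hα.1, by omega⟩), hα.2⟩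
    · have hαm := (mem_filter.mp hα).2
      rw [mem_Icc, not_and_or, not_le, not_le] at hα'
      refine sum_eq_zero fun β hβ => hfar α β ?_
      have hβm := (mem_filter.mp hβ).2
      omega
  rw [← hout]
  -- (ii) restrict the inner sums to `β ∈ [m + 1, m + 1 + r]`
  refine sum_congr rfl fun α hα => ?_
  rw [mem_Icc] at hα
  symm
  refine sum_subset (fun β hβ => ?_) (fun β hβ hβ' => ?_)
  · rw [mem_Icc] at hβ
    exact mem_filter.mpr ⟨hT (mem_Icc.mpr ⟨by omega, hβ.2⟩), by omega⟩
  · have hβm := (mem_filter.mp hβ).2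
    rw [mem_Icc, not_and_or, not_le, not_le] at hβ'
    refine hfar α β ?_
    omega

/-- ★★ THE INCREMENT FORM OF THE CHAIN FLUX: for every carrier containing the band box `[m − r, m + 1 + r]` (`r = ⌊ϱ/c⌋₊`),
`chainFlux T cf m = Σ_{k ∈ [m − r, m + r]} fluxBlock m k (cf (k+1) − cf k)` — the flux through a gap is a banded operator on the nearest-layer
INCREMENTS (telescoping `cf β − cf α = Σ_{α ≤ k < β} (cf (k+1) − cf k)` inside every entry of the band box, then exchanging the sums; the
`k`-sections of the box are exactly the ranges of `fluxBlock m k`). [this file, g58] -/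
theorem chainFlux_eq_sum_fluxBlock (hc : 0 < c) (hL : IsLayeredCrystal c a b w) {ϱ : ℝ} (cf : ℤ → E3) {T : Finset ℤ} {m : ℤ}
    (hT : Icc (m - ⌊ϱ / c⌋₊) (m + 1 + ⌊ϱ / c⌋₊) ⊆ T) :
    chainFlux ϱ a b w T cf m = ∑ k ∈ Icc (m - ⌊ϱ / c⌋₊) (m + ⌊ϱ / c⌋₊), fluxBlock hc hL ϱ m k (cf (k + 1) - cf k) := by
  rw [chainFlux_eq_box hc hL cf hT]
  -- telescoping inside each entry of the band box
  have htel : ∀ α ∈ Icc (m - (⌊ϱ / c⌋₊ : ℤ)) m, ∀ β ∈ Icc (m + 1) (m + 1 + (⌊ϱ / c⌋₊ : ℤ)),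
      chainK ϱ a b w ((0 : Cell 2), α) β (cf β - cf α) = ∑ k ∈ Icc (m - (⌊ϱ / c⌋₊ : ℤ)) (m + ⌊ϱ / c⌋₊),
        if α ≤ k ∧ k < β then chainK ϱ a b w ((0 : Cell 2), α) β (cf (k + 1) - cf k) else 0 := by
    intro α hα β hβ
    rw [mem_Icc] at hα hβ
    have hαβ : α ≤ β := by omega
    have hIk : ∀ k, α ≤ k → k < β → k ∈ Icc (m - (⌊ϱ / c⌋₊ : ℤ)) (m + ⌊ϱ / c⌋₊) := fun k h1 h2 => mem_Icc.mpr ⟨by omega, by omega⟩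
    rw [← sum_filter_sub_eq cf hαβ hIk, ← chainKL_apply hc hL ϱ α β, map_sum, sum_filter]
    simp only [chainKL_apply]
  rw [sum_congr rfl fun α hα => sum_congr rfl fun β hβ => htel α hα β hβ]
  -- exchange the sums and read off the `k`-sections of the box
  calc ∑ α ∈ Icc (m - (⌊ϱ / c⌋₊ : ℤ)) m, ∑ β ∈ Icc (m + 1) (m + 1 + (⌊ϱ / c⌋₊ : ℤ)), ∑ k ∈ Icc (m - (⌊ϱ / c⌋₊ : ℤ)) (m + ⌊ϱ / c⌋₊),
          (if α ≤ k ∧ k < β then chainK ϱ a b w ((0 : Cell 2), α) β (cf (k + 1) - cf k) else 0)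
      = ∑ α ∈ Icc (m - (⌊ϱ / c⌋₊ : ℤ)) m, ∑ k ∈ Icc (m - (⌊ϱ / c⌋₊ : ℤ)) (m + ⌊ϱ / c⌋₊), ∑ β ∈ Icc (m + 1) (m + 1 + (⌊ϱ / c⌋₊ : ℤ)),
          (if α ≤ k ∧ k < β then chainK ϱ a b w ((0 : Cell 2), α) β (cf (k + 1) - cf k) else 0) := sum_congr rfl fun α _ => sum_comm
    _ = ∑ k ∈ Icc (m - (⌊ϱ / c⌋₊ : ℤ)) (m + ⌊ϱ / c⌋₊), ∑ α ∈ Icc (m - (⌊ϱ / c⌋₊ : ℤ)) m, ∑ β ∈ Icc (m + 1) (m + 1 + (⌊ϱ / c⌋₊ : ℤ)),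
          (if α ≤ k ∧ k < β then chainK ϱ a b w ((0 : Cell 2), α) β (cf (k + 1) - cf k) else 0) := sum_comm
    _ = ∑ k ∈ Icc (m - (⌊ϱ / c⌋₊ : ℤ)) (m + ⌊ϱ / c⌋₊), fluxBlock hc hL ϱ m k (cf (k + 1) - cf k) := by
        refine sum_congr rfl fun k _ => ?_
        have hA : ((Icc (m - (⌊ϱ / c⌋₊ : ℤ)) m).filter fun α => α ≤ k) = Icc (m - (⌊ϱ / c⌋₊ : ℤ)) (min m k) := by
          ext α
          simp only [mem_filter, mem_Icc, le_min_iff]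
          omega
        have hB : ((Icc (m + 1) (m + 1 + (⌊ϱ / c⌋₊ : ℤ))).filter fun β => k < β) = Icc (max m k + 1) (m + 1 + (⌊ϱ / c⌋₊ : ℤ)) := by
          ext β
          simp only [mem_filter, mem_Icc, Int.add_one_le_iff, max_lt_iff]
          omega
        have hrow : ∀ α ∈ Icc (m - (⌊ϱ / c⌋₊ : ℤ)) m,
            ∑ β ∈ Icc (m + 1) (m + 1 + (⌊ϱ / c⌋₊ : ℤ)), (if α ≤ k ∧ k < β then chainK ϱ a b w ((0 : Cell 2), α) β (cf (k + 1) - cf k) else 0) =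
              if α ≤ k then ∑ β ∈ Icc (m + 1) (m + 1 + (⌊ϱ / c⌋₊ : ℤ)) with k < β, chainK ϱ a b w ((0 : Cell 2), α) β (cf (k + 1) - cf k)
              else 0 := by
          intro α _
          by_cases hαk : α ≤ k
          · simp only [hαk, true_and, if_true, sum_filter]
          · simp only [hαk, false_and, if_false, sum_const_zero]
        rw [sum_congr rfl hrow, ← sum_filter, hA, hB, fluxBlock_apply]

/-! ### VP.4  Profiles of increment fields -/

/-- the PROFILE of an increment field from the base layer `l`: `primZ d l n = Σ_{k ∈ [l, n)} d k` (zero for `n ≤ l`). [this file, g58] -/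
def primZ (d : ℤ → E3) (l n : ℤ) : E3 :=
  ∑ k ∈ Ico l n, d k

/-- the profile vanishes at and below the base layer. [formal bookkeeping] -/
theorem primZ_of_le (d : ℤ → E3) {l n : ℤ} (h : n ≤ l) : primZ d l n = 0 := by
  unfold primZ
  rw [Ico_eq_empty_of_le h, sum_empty]

/-- the increments of the profile above the base layer are the field. [formal bookkeeping] -/
theorem primZ_succ_sub (d : ℤ → E3) {l n : ℤ} (h : l ≤ n) : primZ d l (n + 1) - primZ d l n = d n := by
  unfold primZ
  have h3 : Ico n (n + 1) = {n} := by
    ext x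
    rw [mem_Ico, mem_singleton]
    omega
  rw [← Ico_union_Ico_eq_Ico h (by omega : n ≤ n + 1), sum_union (Ico_disjoint_Ico_consecutive _ _ _), h3, sum_singleton, add_sub_cancel_left]

/-- ★ for a field vanishing below the base layer, the increments of its profile are the field EVERYWHERE. [this file, g58] -/
theorem primZ_succ_sub' (d : ℤ → E3) {l : ℤ} (hd : ∀ n, n < l → d n = 0) (n : ℤ) : primZ d l (n + 1) - primZ d l n = d n := by
  rcases le_or_gt l n with h | h
  · exact primZ_succ_sub d h
  · rw [primZ_of_le d (by omega : n + 1 ≤ l), primZ_of_le d h.le, sub_zero, hd n h]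

end IncrementForm

end Summit.AtomisticToContinuum.Crystallization.Theorems.ChartedZeroExcessLayeredLatticeLiouville
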